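import Literature.NumberTheory.EllipticCurves.HeegnerPointsKolyvaginSplitDescentData
import Summits.BirchSwinnertonDyer.BirchSwinnertonDyer.Theorems.CMKolyvaginAtInertTwoAdaptiveStep
import HarnessLib

/-!
# Route `CMKolyvaginAtInertTwo`, crux `CMKolyvaginExactAtInertTwo` (stmt-BirchSwinnertonDyer-24277):
# THE ADAPTIVE SPLIT-FORM CASSELS–TATE TELESCOPE OVER THE DATA CARRIER `SplitDataM`, I: ONE
# KOLYVAGIN PRIME (McCallum Thm. 5.4 (21)–(23)) — the non-vacuous-at-2 re-basing of p672194

Seat `bsd-line-cmk2-p1` g13 (cell `bsd-print-cf2`); helper (`--supports stmt-BirchSwinnertonDyer-24277`).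
THEOREMS ONLY: no definition, no named fact, no `sorry`; no item is closed; BSD is not proved by this.
RE-BASING. The sibling files `…AdaptiveTelescopeStep` / `…AdaptiveTelescope` (p672194 / p672541)
prove g12's T4 SPEC over the tree's `SplitHypothesesM`, whose FIELD `cebotarev` (Cor. 3.2 for
independent pure families, kernel form) is UNSATISFIABLE in the `p = 2` pair model (family
`{(jh, 0), (0, j′h)}`; see the module docstring of `Literature.….HeegnerPointsKolyvaginSplitDescentData`):
no `S : SplitHypothesesM` exists at `2`, so those theorems are vacuous there. The proofs use only the
DATA fields; this file and its sequel `…AdaptiveDataTelescope` restate and re-prove them VERBATIM over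
the data carrier `KolyvaginDescent.SplitDataM` (= `SplitHypothesesM` minus `duality`, `cebotarev`),
which the pair model CAN instantiate, with the `p = 2`-correct Čebotarev input as the HYPOTHESIS
`hCeb₂` (order form, bottoms compared modulo `Δ`). THIS FILE: the single step (one Kolyvagin prime);
the sequel: the induction and the bound `#Zp · #Zm ≤ p^{M₀}`.

WHAT. `Literature.….SplitHypothesesM.sum_expo_le_M₀_of_casselsTate_pure` (McCallum 1991 Thm. 5.4
"≤" / Cor. 5.6 in telescope form, split currency) runs McCallum's induction (16)–(23) with a FIXED
family of lifts `s_i` and a Čebotarev binder `hCeb` in kernel form which is FALSE at `p = 2` as typed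
(memo §1: at `2` a full/zero prescription on eigenclasses is realisable iff the bottoms of the full
classes avoid the `p`-torsion of the zero-prescribed span — both signs together — modulo
`Δ = ker(V → H¹(K, E[2^M]))`). Here the same theorem is proved in the ADAPTIVE form that the
`p = 2` criterion allows:
* the lifts are two finite isotropic LIFT GROUPS `Zp ≤ Sel ∩ V^{ε}`, `Zm ≤ Sel ∩ V^{-ε}`, independent
  of `ℤx`, with **(IND)** `(Zp ⊔ Δ) ⊓ Zm = ⊥` for a subgroup `Δ ≤ V` meeting both eigengroups
  trivially;
* the binder **`hCeb₂`** is in ORDER form with the two bottoms hypotheses (`g₁` full: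
  `p^{expo g₁ - 1} g₁ ∉ Δ ⊔ ⟨T⟩`; `g₂` of local order `≥ p^I`: `p^{I-1} g₂ ∉ Δ + ⟨T⟩_{-ν} + ⟨T⟩_{ν}[p]`);
* at every step of the induction the next generator `z` (of maximal order in the ACTIVE pool) and
  the new pool `Z'` are produced by `KolyvaginAdaptiveTwo.exists_split_not_mem_sup` (p669796) from
  the bottom `β = p^{I-1} c(n_k)` of the current Kolyvagin class, which avoids the PASSIVE pool
  `⊔ Δ` by the invariant (I) and purity (memo (F1));
* conclusion `#Zp · #Zm ≤ p^{M₀}`.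
The state of the induction (sequel, `card_mul_card_mul_pow_le`): the chain `n` (`KolSupp`), the
used exponent `Sg`, the two pools `Act` (sign `ε(-1)^{r(n)+1}`) and `Pas` (sign `ε(-1)^{r(n)}`),
McCallum's (19)/(23) "the pools vanish at the primes of `n`", and gk2's invariant **(I)**
`p^i c(n) ∈ Act ⊔ Pas ⟹ (M - M₀) + Sg ≤ i`; here: `adaptive_step` = one Kolyvagin prime
(a step with `Act = ⊥` is McCallum's "dummy" prime `g₁ = 0`), with the (F1) lemma
`pow_zsmul_not_mem_sup_of_invariant`.

References: [McCallumLMS1991] §5 Thm. 5.4 (proof, (16)–(23)), Cor. 5.6, Prop. 4.7, Lemma 5.3,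
Prop. 3.1 / Cor. 3.2 (held `book:editornd-l-functions-arithmetic`, PDF pp. 280, 283–290).
-/

-- single-conjunct summit: `Summit.BirchSwinnertonDyer.BirchSwinnertonDyer.…` repeats the name by design
set_option linter.dupNamespace false
set_option autoImplicit false

open scoped Classical

namespace Summit.BirchSwinnertonDyer.BirchSwinnertonDyer.Theorems.KolyvaginAdaptiveData

open Literature.NumberTheory.EllipticCurves Literature.NumberTheory.EllipticCurves.KolyvaginDescent
open KolyvaginAdaptiveTwo (exists_split_not_mem_sup)

variable {V : Type*} [AddCommGroup V] {Pl : Type*}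

/-! ## Plumbing: thin wrappers over the `SplitDataM.expo` API -/

/-- `p^{expo s} • s = 0`. [folklore] -/
private theorem pow_expo_zsmul (S : SplitDataM V Pl) (s : V) : ((S.p : ℤ) ^ S.expo s) • s = 0 :=
  (S.expo_spec s).1

/-- `p^{expo s - 1} • s ≠ 0` when `expo s ≠ 0`. [folklore] -/
private theorem pow_expo_sub_one_zsmul_ne_zero (S : SplitDataM V Pl) {s : V} (h : S.expo s ≠ 0) :
    ((S.p : ℤ) ^ (S.expo s - 1)) • s ≠ 0 :=
  (S.expo_spec s).2 _ (Nat.sub_one_lt h)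

/-- `expo s ≠ 0` for `s ≠ 0`. [folklore] -/
private theorem expo_ne_zero_of_ne_zero (S : SplitDataM V Pl) {s : V} (hs : s ≠ 0) : S.expo s ≠ 0 :=
  fun h ↦ hs ((S.expo_le_M_and_eq_zero_iff s).2.mp h)

/-! ## (F1): the bottom of the current Kolyvagin class avoids the passive pool `⊔ Δ` -/

/-- **Purity modulo `Δ`.** If `Δ` meets both eigengroups trivially and `P ≤ V^{e}`, then a class of
`V^{e}` lying in `P ⊔ Δ` lies in `P`. [folklore] -/
theorem mem_of_mem_sup_of_eig (S : SplitDataM V Pl) {Δ P : AddSubgroup V}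
    (hΔpure : ∀ d ∈ Δ, ∀ e : ℤ, (e = 1 ∨ e = -1) → d ∈ S.eig e → d = 0)
    {e : ℤ} (he : e = 1 ∨ e = -1) (hP : ∀ u ∈ P, u ∈ S.eig e) {g : V} (hg : g ∈ S.eig e)
    (hmem : g ∈ P ⊔ Δ) : g ∈ P := by
  obtain ⟨u, hu, d, hd, hud⟩ := AddSubgroup.mem_sup.mp hmem
  have hdeig : d ∈ S.eig e := by
    have : d = g - u := by rw [← hud]; abel
    rw [this]
    exact (S.eig e).sub_mem hg (hP u hu)
  have hd0 : d = 0 := hΔpure d hd e he hdeig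
  rw [hd0, add_zero] at hud
  exact hud ▸ hu

/-- **(F1) (memo `MEMO-T5-adaptive-splitting` §3, KERNEL-STATUS §11 item 6 (b)).** With the
invariant (I) "`p^i g ∈ Act ⊔ Pas ⟹ I ≤ i`" for a class `g ∈ V^{-ν}`, a passive pool `Pas ≤ V^{-ν}`
and `Δ` pure-free, the bottom `β = p^{I-1} g` does not lie in `Pas ⊔ Δ` (`I ≥ 1`).
[cite: McCallumLMS1991, §5 Thm. 5.4 (proof, (20)–(21), PDF p. 289)] -/
theorem pow_zsmul_not_mem_sup_of_invariant (S : SplitDataM V Pl) {Δ Act Pas : AddSubgroup V}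
    (hΔpure : ∀ d ∈ Δ, ∀ e : ℤ, (e = 1 ∨ e = -1) → d ∈ S.eig e → d = 0)
    {ν : ℤ} (hν : ν = 1 ∨ ν = -1) (hPas : ∀ u ∈ Pas, u ∈ S.eig (-ν)) {g : V}
    (hg : g ∈ S.eig (-ν)) {I : ℕ} (hI : ∀ i : ℕ, ((S.p : ℤ) ^ i) • g ∈ Act ⊔ Pas → I ≤ i)
    (h1 : 1 ≤ I) : ((S.p : ℤ) ^ (I - 1)) • g ∉ Pas ⊔ Δ := by
  intro hmem
  have hν' : -ν = 1 ∨ -ν = -1 := by rcases hν with h | h <;> simp [h]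
  have hP : ((S.p : ℤ) ^ (I - 1)) • g ∈ Pas :=
    mem_of_mem_sup_of_eig S hΔpure hν' hPas ((S.eig (-ν)).zsmul_mem hg _) hmem
  have := hI (I - 1) (AddSubgroup.mem_sup_right hP)
  omega

/-! ## One Kolyvagin prime: McCallum's step (21)–(23) with the adaptive choice of `c_{k+1}` -/

/-- **THE ADAPTIVE STEP of McCallum's Thm. 5.4 at any prime `p`, over the data carrier `SplitDataM`
(memo §3; KERNEL-STATUS §11 items 6–7; the `SplitHypothesesM` version is
`KolyvaginAdaptiveTwo.adaptive_step`).** State: a chain `n ∈ S_r`, a used exponent `Sg`, an ACTIVE pool `Act ≤ V^{ε(-1)^{r+1}}` and a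
PASSIVE pool `Pas ≤ V^{ε(-1)^{r}}` inside the isotropic group `W ≤ Sel` (room `expo + M₀ ≤ M`),
`Act` disjoint from `Pas ⊔ Δ` ((IND)), the pools vanishing at the primes of `n` ((19)/(23)) and the
invariant **(I)** `p^i c(n) ∈ Act ⊔ Pas ⟹ (M - M₀) + Sg ≤ i`. Output: a Kolyvagin prime `ℓ ∤ n`
(from the order-form binder `hCeb₂`, fed with `g₁ = z` of maximal order in `Act` and the new pool
`Z'`, `Act = ⟨z⟩ ⊕ Z'`, produced by `exists_split_not_mem_sup` from the bottom `p^{I-1} c(n)`, which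
avoids `Pas ⊔ Δ` by (F1); `g₁ = 0`, `Z' = Act` if `Act = ⊥`), with `#Act = p^{expo z} · #Z'`, the
pools `Z'`, `Pas` vanishing at the primes of `ℓ n`, and (I) for `ℓ n` with `Sg + expo z` — the last
by Fact B (`p^i c(n)_λ ≠ 0` for `i < I`) and, when `expo z ≠ 0`, the Cassels–Tate value `hCTV`
(Prop. 4.7 + Lemma 5.3 + Prop. 4.4 with `t := z`, full at `λ`) against the isotropy of `W`.
[cite: McCallumLMS1991, §5 Thm. 5.4 (proof, (16)–(23)), Prop. 4.7, Lemma 5.3, Cor. 3.2 (PDF pp. 283–290)] -/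
theorem adaptive_step (S : SplitDataM V Pl) {R : Type*} [AddCommGroup R] (P : S.Sel →+ S.Sel →+ R)
    (hCTV : ∀ ℓ m : ℕ, S.Kol ℓ → KolSupp S.Kol (ℓ * m) → ¬ ℓ ∣ m →
      ∀ (j N a b : ℕ) (t : V) (ht : t ∈ S.Sel) (hz : ((S.p : ℤ) ^ j) • S.c (ℓ * m) ∈ S.Sel),
      ((S.p : ℤ) ^ N) • t = 0 → t ∈ S.eig (S.ε * (-1) ^ (ℓ * m).primeFactors.card) →
      (∀ q ∈ m.primeFactors, t ∈ S.A q) → S.M - S.M₀ ≤ j → N + S.M₀ ≤ S.M → N ≤ j → a + b + 1 = N →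
      ((S.p : ℤ) ^ (a + (j - N))) • S.c m ∉ S.A ℓ → ((S.p : ℤ) ^ b) • t ∉ S.A ℓ →
      P ⟨_, hz⟩ ⟨t, ht⟩ ≠ 0)
    (Δ : AddSubgroup V)
    (hΔpure : ∀ d ∈ Δ, ∀ e : ℤ, (e = 1 ∨ e = -1) → d ∈ S.eig e → d = 0)
    (hCeb₂ : ∀ (T : Finset V) (g₁ g₂ : V) (ν : ℤ) (I : ℕ), (ν = 1 ∨ ν = -1) → g₁ ∈ S.eig ν →
      g₂ ∈ S.eig (-ν) → (∀ t ∈ T, ∃ e : ℤ, (e = 1 ∨ e = -1) ∧ t ∈ S.eig e) →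
      (g₁ ≠ 0 → ((S.p : ℤ) ^ (S.expo g₁ - 1)) • g₁ ∉ Δ ⊔ AddSubgroup.closure (T : Set V)) →
      (1 ≤ I → ∀ d ∈ Δ, ∀ u ∈ AddSubgroup.closure (T : Set V), u ∈ S.eig (-ν) →
        ∀ v ∈ AddSubgroup.closure (T : Set V), v ∈ S.eig ν → (S.p : ℤ) • v = 0 →
        ((S.p : ℤ) ^ (I - 1)) • g₂ ≠ d + u + v) →
      ∀ b : ℕ, ∃ ℓ, b < ℓ ∧ S.Kol ℓ ∧
        (∀ t ∈ AddSubgroup.closure (T : Set V), t ∈ S.A ℓ) ∧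
        (∀ j < S.expo g₁, ((S.p : ℤ) ^ j) • g₁ ∉ S.A ℓ) ∧
        (∀ i < I, ((S.p : ℤ) ^ i) • g₂ ∉ S.A ℓ))
    (W : AddSubgroup V) (hWSel : W ≤ S.Sel)
    (hiso : ∀ u, ∀ hu : u ∈ W, ∀ v, ∀ hv : v ∈ W, ∀ (hu' : u ∈ S.Sel) (hv' : v ∈ S.Sel),
      P ⟨u, hu'⟩ ⟨v, hv'⟩ = 0)
    (hroom : ∀ z ∈ W, S.expo z + S.M₀ ≤ S.M)
    (Act Pas : AddSubgroup V) [Finite Act] [Finite Pas] (hAct : Act ≤ W) (hPas : Pas ≤ W)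
    (hdisj : Disjoint Act (Pas ⊔ Δ)) {n : ℕ} (hn : KolSupp S.Kol n) (Sg : ℕ)
    (hActν : ∀ z ∈ Act, z ∈ S.eig (S.ε * (-1) ^ (n.primeFactors.card + 1)))
    (hPasν : ∀ u ∈ Pas, u ∈ S.eig (S.ε * (-1) ^ n.primeFactors.card))
    (hA : ∀ q ∈ n.primeFactors, ∀ z ∈ Act ⊔ Pas, z ∈ S.A q)
    (hI : ∀ i : ℕ, ((S.p : ℤ) ^ i) • S.c n ∈ Act ⊔ Pas → (S.M - S.M₀) + Sg ≤ i) :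
    ∃ (ℓ : ℕ) (Z' : AddSubgroup V) (e : ℕ), S.Kol ℓ ∧ KolSupp S.Kol (ℓ * n) ∧
      (ℓ * n).primeFactors.card = n.primeFactors.card + 1 ∧ Z' ≤ Act ∧
      Nat.card Act = S.p ^ e * Nat.card Z' ∧ (Act ≠ ⊥ → e ≠ 0) ∧
      (∀ q ∈ (ℓ * n).primeFactors, ∀ z ∈ Z' ⊔ Pas, z ∈ S.A q) ∧
      ∀ i : ℕ, ((S.p : ℤ) ^ i) • S.c (ℓ * n) ∈ Z' ⊔ Pas → (S.M - S.M₀) + (Sg + e) ≤ i := by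
  have hp := S.hp
  set r := n.primeFactors.card with hr
  set ν : ℤ := S.ε * (-1) ^ (r + 1) with hν
  have hν1 : ν = 1 ∨ ν = -1 := S.sign_pow_cases (r + 1)
  have hnegν : -ν = S.ε * (-1) ^ r := by rw [hν, pow_succ]; ring
  have hν1' : -ν = 1 ∨ -ν = -1 := by rcases hν1 with h | h <;> simp [h]
  have hτc : S.c n ∈ S.eig (-ν) := by rw [hnegν]; exact S.c_eig n hn
  have hPasν' : ∀ u ∈ Pas, u ∈ S.eig (-ν) := by rw [hnegν]; exact hPasν
  set I := S.M - S.M₀ + Sg with hIdef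
  -- (F1): the bottom `p^{I-1} c(n)` avoids `Pas ⊔ Δ`
  have hF1 : 1 ≤ I → ((S.p : ℤ) ^ (I - 1)) • S.c n ∉ Pas ⊔ Δ := fun h1 ↦
    pow_zsmul_not_mem_sup_of_invariant S hΔpure hν1 hPasν' hτc hI h1
  -- ### the generator `z` (McCallum's `c_{k+1}`, of maximal order in `Act`) and the new pool `Z'`
  have hgen : ∃ z ∈ Act, ∃ Z' : AddSubgroup V, Z' ≤ Act ∧ AddSubgroup.zmultiples z ⊓ Z' = ⊥ ∧
      AddSubgroup.zmultiples z ⊔ Z' = Act ∧ (Act ≠ ⊥ → z ≠ 0) ∧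
      (1 ≤ I → ((S.p : ℤ) ^ (I - 1)) • S.c n ∉ Z' ⊔ (Pas ⊔ Δ)) ∧
      ∀ m : ℤ, m • z ≠ 0 → m • z ∉ Z' ⊔ (Pas ⊔ Δ) := by
    by_cases hbot : Act = ⊥
    · -- dummy step: `g₁ = 0`, `Z' = ⊥ = Act`
      refine ⟨0, zero_mem _, ⊥, bot_le, by simp, ?_, fun h ↦ (h hbot).elim, fun h1 ↦ ?_,
        fun m hm ↦ (hm (zsmul_zero m)).elim⟩
      · rw [AddSubgroup.zmultiples_zero_eq_bot, bot_sup_eq, hbot]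
      · rw [bot_sup_eq]
        exact hF1 h1
    · -- real step: `I ≥ 1` since `Act` has a non-zero element (`expo ≥ 1`, room `expo + M₀ ≤ M`)
      obtain ⟨⟨z₀, hz₀⟩, hz₀ne⟩ := AddSubgroup.ne_bot_iff_exists_ne_zero.mp hbot
      have hz₀ne' : z₀ ≠ 0 := fun h ↦ hz₀ne (Subtype.ext h)
      have h1 : 1 ≤ I := by
        have he := expo_ne_zero_of_ne_zero S hz₀ne'
        have := hroom z₀ (hAct hz₀)
        omega
      obtain ⟨z, hz, hzord, Z', hZ'le, hinf, hsup, -, hβ, hmult⟩ :=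
        exists_split_not_mem_sup Act (Pas ⊔ Δ) hbot hdisj (hF1 h1)
      refine ⟨z, hz, Z', hZ'le, hinf, hsup, fun _ hz0 ↦ ?_, fun _ ↦ hβ, hmult⟩
      apply hz₀ne
      have hdvd := AddMonoid.addOrder_dvd_exponent (⟨z₀, hz₀⟩ : Act)
      rw [← hzord, hz0, addOrderOf_zero, Nat.dvd_one] at hdvd
      exact AddMonoid.addOrderOf_eq_one_iff.mp hdvd
  obtain ⟨z, hz, Z', hZ'le, hinf, hsup, hzne, hβ, hmult⟩ := hgen
  haveI : Finite Z' :=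
    Finite.of_injective (AddSubgroup.inclusion hZ'le) (AddSubgroup.inclusion_injective hZ'le)
  -- ### the finite generating set `T` of the new pool `Z' ⊔ Pas`
  have hTfin : ((Z' : Set V) ∪ (Pas : Set V)).Finite := (Set.toFinite _).union (Set.toFinite _)
  set T : Finset V := hTfin.toFinset with hT
  have hTcoe : (T : Set V) = (Z' : Set V) ∪ (Pas : Set V) := hTfin.coe_toFinset
  have hclT : AddSubgroup.closure (T : Set V) = Z' ⊔ Pas := by
    rw [hTcoe, AddSubgroup.closure_union, AddSubgroup.closure_eq, AddSubgroup.closure_eq]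
  have hzν : z ∈ S.eig ν := hActν z hz
  have hTpure : ∀ t ∈ T, ∃ e : ℤ, (e = 1 ∨ e = -1) ∧ t ∈ S.eig e := by
    intro t ht
    rw [← Finset.mem_coe, hTcoe, Set.mem_union] at ht
    rcases ht with ht | ht
    · exact ⟨ν, hν1, hActν t (hZ'le ht)⟩
    · exact ⟨-ν, hν1', hPasν' t ht⟩
  have hsupeq : Δ ⊔ AddSubgroup.closure (T : Set V) = Z' ⊔ (Pas ⊔ Δ) := by
    rw [hclT, sup_comm, sup_assoc]
  -- (22): `z` will be FULL at `λ` — its bottom avoids `Δ ⊔ ⟨T⟩`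
  have hfull : z ≠ 0 → ((S.p : ℤ) ^ (S.expo z - 1)) • z ∉ Δ ⊔ AddSubgroup.closure (T : Set V) := by
    intro hz0
    rw [hsupeq]
    exact hmult _ (pow_expo_sub_one_zsmul_ne_zero S (expo_ne_zero_of_ne_zero S hz0))
  -- (21): `c(n)` of local order `≥ p^I` — its `p^{I-1}`-multiple avoids `Δ + ⟨T⟩`
  have hrel : 1 ≤ I → ∀ d ∈ Δ, ∀ u ∈ AddSubgroup.closure (T : Set V), u ∈ S.eig (-ν) →
      ∀ v ∈ AddSubgroup.closure (T : Set V), v ∈ S.eig ν → (S.p : ℤ) • v = 0 →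
      ((S.p : ℤ) ^ (I - 1)) • S.c n ≠ d + u + v := by
    intro h1 d hd u hu _ v hv _ _ heq
    apply hβ h1
    rw [heq]
    rw [hclT] at hu hv
    have hle : Z' ⊔ Pas ≤ Z' ⊔ (Pas ⊔ Δ) := sup_le_sup_left le_sup_left Z'
    exact add_mem (add_mem (AddSubgroup.mem_sup_right (AddSubgroup.mem_sup_right hd)) (hle hu))
      (hle hv)
  -- ### the Kolyvagin prime `ℓ = ℓ_{k+1}`
  obtain ⟨ℓ, hnℓ, hℓ, hTA, hzA, hcA⟩ := hCeb₂ T z (S.c n) ν I hν1 hzν hτc hTpure hfull hrel n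
  rw [hclT] at hTA
  have hℓp := S.prime_of_kol ℓ hℓ
  have hn0 : n ≠ 0 := hn.1.ne_zero
  have hndvd : ¬ ℓ ∣ n := fun h ↦ by
    have := Nat.le_of_dvd (Nat.pos_of_ne_zero hn0) h
    omega
  have hsupp : KolSupp S.Kol (ℓ * n) := S.kolSupp_mul_of_not_dvd hℓ hn hndvd
  have hcard' : (ℓ * n).primeFactors.card = r + 1 :=
    SplitDataM.card_primeFactors_mul_of_not_dvd hℓp hn0 hndvd
  -- `#Act = ord z · #Z' = p^{expo z} · #Z'`
  have hcardAct : Nat.card Act = S.p ^ S.expo z * Nat.card Z' := by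
    have h1 : (AddSubgroup.zmultiples z).relIndex (AddSubgroup.zmultiples z ⊔ Z') = Nat.card Z' := by
      rw [AddSubgroup.relIndex_sup_left, ← AddSubgroup.inf_relIndex_right, hinf,
        AddSubgroup.relIndex_bot_left]
    have h2 := AddSubgroup.relIndex_mul_relIndex ⊥ (AddSubgroup.zmultiples z)
      (AddSubgroup.zmultiples z ⊔ Z') bot_le le_sup_left
    rw [AddSubgroup.relIndex_bot_left, AddSubgroup.relIndex_bot_left, h1, hsup, Nat.card_zmultiples,
      S.addOrderOf_eq_pow_expo z] at h2
    exact h2.symm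
  have hW : Z' ⊔ Pas ≤ W := sup_le (hZ'le.trans hAct) hPas
  refine ⟨ℓ, Z', S.expo z, hℓ, hsupp, hcard', hZ'le, hcardAct,
    fun h ↦ expo_ne_zero_of_ne_zero S (hzne h), ?_, ?_⟩
  · -- (19)/(23): the pools vanish at the primes of `ℓ n`
    intro q hq w hw
    rw [Nat.primeFactors_mul hℓp.ne_zero hn0, Finset.mem_union, hℓp.primeFactors,
      Finset.mem_singleton] at hq
    rcases hq with rfl | hq
    · exact hTA w hw
    · exact hA q hq w (sup_le_sup_right hZ'le Pas hw)
  · -- ### the invariant (I) for `ℓ n`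
    intro i hi
    have hSel : ((S.p : ℤ) ^ i) • S.c (ℓ * n) ∈ S.Sel := hWSel (hW hi)
    have hAℓ : ((S.p : ℤ) ^ i) • S.c n ∈ S.A ℓ :=
      (S.c_mem_loc_iff ℓ n hℓ hsupp i).mp ((S.mem_sel_iff _).mp hSel (S.pl ℓ))
    -- Fact B: `p^i c(n)_λ = 0 ⟹ I ≤ i`
    have hB0 : I ≤ i := by
      by_contra h
      exact hcA i (by omega) hAℓ
    by_cases hN : S.expo z = 0
    · rw [hN]
      omega
    by_contra hlt
    have hroomz := hroom z (hAct hz)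
    have hNi : S.expo z ≤ i := by omega
    -- (21): `p^{i - N} c(n)_λ ≠ 0`
    have hnot : ((S.p : ℤ) ^ (0 + (i - S.expo z))) • S.c n ∉ S.A ℓ := by
      rw [zero_add]
      exact hcA _ (by omega)
    -- (22): `z` has full order at `λ`
    have hzfull : ((S.p : ℤ) ^ (S.expo z - 1)) • z ∉ S.A ℓ := hzA _ (by omega)
    have hτz : z ∈ S.eig (S.ε * (-1) ^ (ℓ * n).primeFactors.card) := by
      rw [hcard']
      exact hzν
    have hAq : ∀ q ∈ n.primeFactors, z ∈ S.A q := fun q hq ↦ hA q hq z (AddSubgroup.mem_sup_left hz)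
    have hzSel : z ∈ S.Sel := hWSel (hAct hz)
    have hne := hCTV ℓ n hℓ hsupp hndvd i (S.expo z) 0 (S.expo z - 1) z hzSel hSel
      (pow_expo_zsmul S z) hτz hAq (by omega) hroomz hNi (by omega) hnot hzfull
    -- isotropy of `W ∋ p^i c(ℓ n), z`
    exact hne (hiso _ (hW hi) _ (hAct hz) hSel hzSel)

end Summit.BirchSwinnertonDyer.BirchSwinnertonDyer.Theorems.KolyvaginAdaptiveData
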